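import Mathlib
import Summits.ResolutionOfSingularities.ResolutionOfSingularities.Theorems.HomologicalConductorPersistencePointedCeilingCurvette
import HarnessLib

/-!
# [OURS · L1 w44b] K-PCC sheaf half, FILE 7: the pointed ceiling for an ARBITRARY curve germ (weighted form) —
# `ca³(T) ⊆ 𝔭·𝔭⁻¹ ⊆ I(Z⁽ᵇ⁾ − A⁽ᵇ⁾)` with `b = ([Γ]·E_i)_i` the multidegree of its strict transform

Rung S-2 `HomologicalConductor.PersistenceSurface` (stmt-ResolutionOfSingularities-19970), route
`ResolutionOfSingularities/HomologicalConductor`, chain W4.4b (cell res-hironaka), WAVE-3 row «stub-3 → K-PCC SHEAF HALF»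
(lead memo K-PCC Thm 2.3; tri-1 REFEREE-K-PCC-EK2 finding F1: over a non-closed residue field a curvette at `C_t` has degree
`m_t = h⁰(E_t)`, not `1`). `[OURS · L1 w44b]`; NOT a statement of the manuscript under review; AI-written, weaker than expert
review. This file removes the hypothesis `([Γ]·E_i) = δ_it` of FILE 4b `…PointedCeilingCurvette` altogether: for ANY
codimension-one point `γ` off the closed fibre (any curve germ `π(Γ) ⊂ Spec T`, prime `𝔭 = π(γ)`), with WEIGHT VECTOR
`b i := ([Γ]·E_i) ≥ 0`, the sets `𝒫_b = {Z ≥ 0 : Z·C_i ≤ −b_i}` and `𝒜_b = {A ≥ 0 : A·C_i ≥ −b_i}` replace `𝒫_t`, `𝒜_t`,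
and `ca³(T) ⊆ 𝔭·𝔭⁻¹ ⊆ I(min 𝒫_b − max 𝒜_b)`. The curvette case is `b = δ_t`; the index-`m_t` case is `b = m_t δ_t`.

* lattice (weight vector `b ≥ 0`, generalising lead-1's `…PointedCyclesDefinite` verbatim): `negPart_almostNef_weighted`
  (`Q·C_i ≤ b_i ⇒ Q⁻·C_i ≥ −b_i`), **`least_sub_greatest_le_add_weighted`** (`P·C ≤ −b`, `Q·C ≤ b ⇒ Z₀ − A₀ ≤ P + Q`);
* sheaf: `least_sub_greatest_le_ord_mul_weighted` (FILE 3's ceiling on products for `D` of multidegree `−b`) and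
  **`least_sub_greatest_le_ord_of_mem_cohomologyAnnihilatorOfDegree_three_weighted`** — for every codimension-one `γ` off
  the closed fibre and `b i := ([Γ]·E_i)`: `x ∈ ca³(T)`, `x ≠ 0 ⇒ Z₀ i − A₀ i ≤ ord_{E_i}(x)` for `Z₀ ≤ 𝒫_b`, `A₀ ≥ 𝒜_b`.

References: J. Lipman, Publ. Math. IHÉS 36 (1969), §12, (13.1) a), (14.1) [`Lipman1969`]; memo K-PCC §2, tri-1 F1.
-/

set_option linter.dupNamespace false
set_option autoImplicit false

noncomputable section

open CategoryTheory AlgebraicGeometry TopologicalSpace IsLocalRing Opposite Order Finset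
open Literature.AlgebraicGeometry.Motives Literature.AlgebraicGeometry.Motives.RatFn
open Literature.AlgebraicGeometry.Resolution Literature.RingTheory.CohomologyAnnihilator
open Summit.ResolutionOfSingularities.ResolutionOfSingularities.Theorems.NoZeno.SandwichCluster
open Summit.ResolutionOfSingularities.ResolutionOfSingularities.Theorems.HomologicalConductor.PersistencePointedCyclesDefinite

universe u

namespace Summit.ResolutionOfSingularities.ResolutionOfSingularities.Theorems.HomologicalConductor.PersistencePointedCeiling

/-! ## Lattice: weight vectors -/

section Lattice

variable {ι : Type*} [Fintype ι]

/-- **The negative part of a cycle with `Q·C_i ≤ b_i` is almost nef of weight `b`**: `Q⁻·C_i ≥ −b_i` (`b ≥ 0`; on the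
support of `Q⁻` compare with `−Q·C_i`, off it every term is `≥ 0`). [this work] -/
theorem negPart_almostNef_weighted (M : ι → ι → ℤ) (hoff : ∀ i j, i ≠ j → 0 ≤ M i j) (b : ι → ℤ) (hb : 0 ≤ b)
    (Q : ι → ℤ) (hQ : ∀ i, ∑ j, Q j * M j i ≤ b i) :
    ∀ i, -b i ≤ ∑ j, ((fun j => (max (-Q j) 0).toNat) j : ℤ) * M j i := by
  classical
  intro i
  have hcast : ∀ j, (((max (-Q j) 0).toNat : ℕ) : ℤ) = max (-Q j) 0 := fun j =>
    Int.toNat_of_nonneg (le_max_right _ _)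
  simp only [hcast]
  by_cases hi : Q i < 0
  · have h1 : -∑ j, Q j * M j i ≤ ∑ j, max (-Q j) 0 * M j i := by
      rw [← sum_neg_distrib]
      refine sum_le_sum fun j _ => ?_
      by_cases hji : j = i
      · subst hji; rw [max_eq_left (by linarith), neg_mul]
      · rw [← neg_mul]; exact mul_le_mul_of_nonneg_right (le_max_left _ _) (hoff j i hji)
    linarith [hQ i]
  · have h1 : (0 : ℤ) ≤ ∑ j, max (-Q j) 0 * M j i := by
      refine sum_nonneg fun j _ => ?_
      by_cases hji : j = i
      · subst hji; rw [max_eq_right (by linarith), zero_mul]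
      · exact mul_nonneg (le_max_right _ _) (hoff j i hji)
    have hbi : (0 : ℤ) ≤ b i := hb i
    linarith

/-- **POINTED CEILING, weighted lattice form.** `M` with non-negative off-diagonal entries and negative definite (`hneg`),
`b ≥ 0` a weight vector, `Z₀` below every effective cycle with `Z·C_i ≤ −b_i`, `A₀` above every effective cycle with
`A·C_i ≥ −b_i`. Then for all `P`, `Q : ι → ℤ` with `P·C_i ≤ −b_i`, `Q·C_i ≤ b_i`: **`Z₀ − A₀ ≤ P + Q`** (lead-1's
`least_sub_greatest_le_add` is `b = δ_t`). [this work] -/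
theorem least_sub_greatest_le_add_weighted (M : ι → ι → ℤ) (hoff : ∀ i j, i ≠ j → 0 ≤ M i j)
    (hneg : ∀ N : ι → ℤ, 0 ≤ ∑ i, N i * ∑ j, N j * M j i → N = 0) (b : ι → ℤ) (hb : 0 ≤ b) (Z₀ A₀ : ι → ℕ)
    (hZ₀ : ∀ Z : ι → ℕ, (∀ i, ∑ j, (Z j : ℤ) * M j i ≤ -b i) → Z₀ ≤ Z)
    (hA₀ : ∀ A : ι → ℕ, (∀ i, -b i ≤ ∑ j, (A j : ℤ) * M j i) → A ≤ A₀)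
    (P Q : ι → ℤ) (hP : ∀ i, ∑ j, P j * M j i ≤ -b i) (hQ : ∀ i, ∑ j, Q j * M j i ≤ b i) :
    ∀ i, (Z₀ i : ℤ) - A₀ i ≤ P i + Q i := by
  have hPnn : 0 ≤ P := nonneg_of_antinef M hoff hneg P fun i => by
    have hbi : (0 : ℤ) ≤ b i := hb i
    exact (hP i).trans (by linarith)
  set P' : ι → ℕ := fun i => (P i).toNat with hP'
  have hPP' : ∀ i, ((P' i : ℕ) : ℤ) = P i := fun i => Int.toNat_of_nonneg (hPnn i)
  have hZP : Z₀ ≤ P' := hZ₀ P' fun i => by simp only [hPP']; exact hP i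
  set Qm : ι → ℕ := fun j => (max (-Q j) 0).toNat with hQm
  have hQA : Qm ≤ A₀ := hA₀ Qm (negPart_almostNef_weighted M hoff b hb Q hQ)
  intro i
  have h1 : (Z₀ i : ℤ) ≤ P i := by rw [← hPP' i]; exact_mod_cast hZP i
  have h2 : -(A₀ i : ℤ) ≤ Q i := by
    have h3 : (Qm i : ℤ) ≤ A₀ i := by exact_mod_cast hQA i
    exact le_trans (by linarith) (neg_negPart_le Q i)
  linarith

end Lattice

/-! ## Sheaf: the ceiling for an arbitrary curve germ -/

section Sheaf

variable {X : Scheme.{u}} [IsIntegral X] [IsLocallyNoetherian X] {T : Type u} [CommRing T] [IsLocalRing T] [IsDomain T]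
  [IsNoetherianRing T] [IsIntegrallyClosed T] (π : X ⟶ Spec (.of T)) [IsProper π]

omit [IsDomain T] [IsNoetherianRing T] [IsIntegrallyClosed T] in
/-- **Ceiling on products, weighted** (FILE 3's `least_sub_greatest_le_ord_mul` with `−δ_t` replaced by a weight vector
`−b`, `b ≥ 0`): `D` of multidegree `−b`, `s ∈ H⁰(X∖E, 𝒪(D))`, `s' ∈ H⁰(X∖E, 𝒪(−D))`, non-zero ⇒ `Z₀ i − A₀ i ≤ ord_i(s s')`.
[cite: Lipman1969, Section 12 (pp. 220–221)] -/
theorem least_sub_greatest_le_ord_mul_weighted (hX : Scheme.IsRegular X) (F : Finset X)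
    (hF : ∀ η ∈ F, coheight η = 1) (hFexc : ∀ η ∈ F, η ∈ excCurvePoints π)
    (hFE : ∀ ζ : X, π ζ = closedPoint T → coheight ζ ≤ 1 → ζ ∈ F)
    (hneg : ∀ N : {η // η ∈ F} → ℤ, 0 ≤ ∑ i, N i * ∑ j, N j *
        excCurveDegree π (CartierDivisor.ofIsEffectiveCartier (primeDivisorIdeal (j : X))
          (isEffectiveCartier_primeDivisorIdeal_of_isRegular hX (hF j j.2))) i → N = 0)
    (b : {η // η ∈ F} → ℤ) (hb : 0 ≤ b) (D : CartierDivisor X)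
    (hD : ∀ i : {η // η ∈ F}, excCurveDegree π D i = -b i) (Z₀ A₀ : {η // η ∈ F} → ℕ)
    (hZ₀ : ∀ Z : {η // η ∈ F} → ℕ, (∀ i : {η // η ∈ F}, ∑ j, (Z j : ℤ) *
        excCurveDegree π (CartierDivisor.ofIsEffectiveCartier (primeDivisorIdeal (j : X))
          (isEffectiveCartier_primeDivisorIdeal_of_isRegular hX (hF j j.2))) i ≤ -b i) → Z₀ ≤ Z)
    (hA₀ : ∀ A : {η // η ∈ F} → ℕ, (∀ i : {η // η ∈ F}, -b i ≤ ∑ j, (A j : ℤ) *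
        excCurveDegree π (CartierDivisor.ofIsEffectiveCartier (primeDivisorIdeal (j : X))
          (isEffectiveCartier_primeDivisorIdeal_of_isRegular hX (hF j j.2))) i) → A ≤ A₀)
    {s s' : X.functionField} (hs0 : s ≠ 0) (hs0' : s' ≠ 0)
    (hs : D.IsSectionOn {x | π x ≠ closedPoint T} s)
    (hs' : (-D).IsSectionOn {x | π x ≠ closedPoint T} s') (i : {η // η ∈ F}) :
    (Z₀ i : ℤ) - A₀ i ≤ Scheme.ord (s * s') i := by
  classical
  set M : {η // η ∈ F} → {η // η ∈ F} → ℤ := fun j i => excCurveDegree π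
    (CartierDivisor.ofIsEffectiveCartier (primeDivisorIdeal (j : X))
      (isEffectiveCartier_primeDivisorIdeal_of_isRegular hX (hF j j.2))) i with hMdef
  have hoff : ∀ i j : {η // η ∈ F}, i ≠ j → 0 ≤ M i j := fun i j hij =>
    excCurveDegree_primeDivisor_nonneg_of_ne π hX (hF i i.2) (hF j j.2) (hFexc j j.2)
      fun h => hij (Subtype.ext h)
  set P : {η // η ∈ F} → ℤ := fun j => (D + CartierDivisor.principal s hs0).ordAt j with hPdef
  set Q : {η // η ∈ F} → ℤ := fun j => (-D + CartierDivisor.principal s' hs0').ordAt j with hQdef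
  have hP : ∀ i, ∑ j, P j * M j i ≤ -b i := by
    intro i
    have h := sum_ordAt_mul_excCurveDegree_le_of_isSectionOn π hX F hF hFE D hs0 hs i.2 (hFexc i i.2)
    rw [Finset.attach_eq_univ, hD i] at h
    exact h
  have hQ : ∀ i, ∑ j, Q j * M j i ≤ b i := by
    intro i
    have h := sum_ordAt_mul_excCurveDegree_le_of_isSectionOn π hX F hF hFE (-D) hs0' hs' i.2 (hFexc i i.2)
    rw [Finset.attach_eq_univ, excCurveDegree_neg π (hFexc i i.2), hD i, neg_neg] at h
    exact h
  have hle := least_sub_greatest_le_add_weighted M hoff hneg b hb Z₀ A₀ hZ₀ hA₀ P Q hP hQ i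
  rw [ord_mul_eq_ordAt_add D hs0 hs0']
  exact hle

/-- **THE POINTED CEILING FOR AN ARBITRARY CURVE GERM (weighted K-PCC Thm 2.3).** `T` a normal noetherian local domain
of dimension `2`, `π : X → Spec T` proper birational, `X` integral, locally noetherian, regular; `F` the exceptional curves
(containing every codimension-`≤ 1` point of the closed fibre) with the negative definite pairing `M j i = ([E_j]·E_i)`;
`γ` ANY codimension-one point off the closed fibre, `b i := ([Γ]·E_i)` (automatically `≥ 0`), `𝔭 = π(γ)`; `Z₀ ≤` every
effective cycle with `Z·C_i ≤ −b_i` and `A₀ ≥` every effective cycle with `A·C_i ≥ −b_i`. Then every non-zero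
`x ∈ ca³(T)` has **`Z₀ i − A₀ i ≤ ord_{E_i}(x)`**: `x ∈ 𝔭·𝔭⁻¹` (reflexive rank-one ceiling), `𝔭 ⊆ H⁰(X∖E, 𝒪(−Γ))`,
`𝔭⁻¹ ⊆ H⁰(X∖E, 𝒪(Γ))` (FILE 4b), products by the weighted lattice ceiling, sums by `ord_add`. No curvette hypothesis.
[cite: Lipman1969, Section 12 and Lemma (14.1)] [cite: IyengarTakahashi2014, Remark 2.13] -/
theorem least_sub_greatest_le_ord_of_mem_cohomologyAnnihilatorOfDegree_three_weighted [DecidableEq X]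
    (hX : Scheme.IsRegular X) (hπ : IsBirational π) (hT : ringKrullDim T = 2) (F : Finset X)
    (hF : ∀ η ∈ F, coheight η = 1) (hFexc : ∀ η ∈ F, η ∈ excCurvePoints π)
    (hFE : ∀ ζ : X, π ζ = closedPoint T → coheight ζ ≤ 1 → ζ ∈ F)
    (hneg : ∀ N : {η // η ∈ F} → ℤ, 0 ≤ ∑ i, N i * ∑ j, N j *
        excCurveDegree π (CartierDivisor.ofIsEffectiveCartier (primeDivisorIdeal (j : X))
          (isEffectiveCartier_primeDivisorIdeal_of_isRegular hX (hF j j.2))) i → N = 0)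
    {γ : X} (hγ : coheight γ = 1) (hγE : π.base γ ≠ closedPoint T) (Z₀ A₀ : {η // η ∈ F} → ℕ)
    (hZ₀ : ∀ Z : {η // η ∈ F} → ℕ, (∀ i : {η // η ∈ F}, ∑ j, (Z j : ℤ) *
        excCurveDegree π (CartierDivisor.ofIsEffectiveCartier (primeDivisorIdeal (j : X))
          (isEffectiveCartier_primeDivisorIdeal_of_isRegular hX (hF j j.2))) i ≤
        -excCurveDegree π (CartierDivisor.ofIsEffectiveCartier (primeDivisorIdeal γ)
          (isEffectiveCartier_primeDivisorIdeal_of_isRegular hX hγ)) i) → Z₀ ≤ Z)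
    (hA₀ : ∀ A : {η // η ∈ F} → ℕ, (∀ i : {η // η ∈ F},
        -excCurveDegree π (CartierDivisor.ofIsEffectiveCartier (primeDivisorIdeal γ)
          (isEffectiveCartier_primeDivisorIdeal_of_isRegular hX hγ)) i ≤ ∑ j, (A j : ℤ) *
        excCurveDegree π (CartierDivisor.ofIsEffectiveCartier (primeDivisorIdeal (j : X))
          (isEffectiveCartier_primeDivisorIdeal_of_isRegular hX (hF j j.2))) i) → A ≤ A₀)
    {x : T} (hx : x ∈ cohomologyAnnihilatorOfDegree T 3) (hx0 : x ≠ 0) (i : {η // η ∈ F}) :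
    (Z₀ i : ℤ) - A₀ i ≤ Scheme.ord (baseToFunctionField π x) i := by
  classical
  letI := (baseToFunctionField π).toAlgebra
  haveI : IsDominant π := hπ.isDominant
  haveI : IsFractionRing T X.functionField :=
    isFractionRing_baseToFunctionField π hπ.isIso_stalkMap_genericPoint
  have halg : ∀ a : T, algebraMap T X.functionField a = baseToFunctionField π a := fun _ => rfl
  set 𝔭 : Ideal T := (π.base γ).asIdeal with h𝔭def
  haveI : 𝔭.IsPrime := (π.base γ).isPrime
  haveI := isIso_stalkMap_of_base_ne_closedPoint π hπ hT.le hγE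
  have h𝔭1 : 𝔭.height = 1 := by
    have hd := ringKrullDim_stalk_eq_coheight γ
    rw [hγ] at hd
    have e := (asIso (π.stalkMap γ)).commRingCatIsoToRingEquiv
    have hd' : ringKrullDim ((Spec (.of T)).presheaf.stalk (π.base γ)) = (1 : ℕ∞) := by
      rw [ringKrullDim_eq_of_ringEquiv e]; exact hd
    letI : Algebra T ((Spec (.of T)).presheaf.stalk (π.base γ)) := StructureSheaf.stalkAlgebra T (π.base γ)
    haveI : IsLocalization.AtPrime ((Spec (.of T)).presheaf.stalk (π.base γ)) (π.base γ).asIdeal :=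
      StructureSheaf.IsLocalization.to_stalk T (π.base γ)
    rw [IsLocalization.AtPrime.ringKrullDim_eq_height (π.base γ).asIdeal
      ((Spec (.of T)).presheaf.stalk (π.base γ))] at hd'
    exact_mod_cast hd'
  haveI : Module.IsReflexive T ↥𝔭 := isReflexive_of_height_eq_one 𝔭 h𝔭1
  have h𝔭0 : 𝔭 ≠ ⊥ := Ideal.ne_bot_of_height_eq_one h𝔭1
  have hxmem := PersistenceConductorCeiling.algebraMap_mem_mul_inv_of_isReflexive
    (K := X.functionField) 𝔭 h𝔭0 hx
  rw [halg] at hxmem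
  set DΓ := CartierDivisor.ofIsEffectiveCartier (primeDivisorIdeal γ)
    (isEffectiveCartier_primeDivisorIdeal_of_isRegular hX hγ) with hDΓ
  -- the weight vector `b = ([Γ]·E_i) ≥ 0`
  set b : {η // η ∈ F} → ℤ := fun i => excCurveDegree π DΓ i with hbdef
  have hb : 0 ≤ b := fun i => by
    have hγF : (γ : X) ≠ (i : X) := by
      intro h
      have := (hFexc i i.2).1
      rw [← h] at this
      exact hγE this
    refine excCurveDegree_nonneg_of_isEffective π (hFexc i i.2)
      (CartierDivisor.isEffective_ofIsEffectiveCartier _ _) ?_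
    rw [CartierDivisor.avoids_ofIsEffectiveCartier_iff, mem_support_primeDivisorIdeal_iff]
    exact not_specializes_of_coheight_eq_one hγ (hF i i.2) hγF
  have hD : ∀ i : {η // η ∈ F}, excCurveDegree π (-DΓ) i = -b i := fun i => by
    rw [excCurveDegree_neg π (hFexc i i.2)]
  have hcoh : ∀ y : X, π.base y ≠ closedPoint T → coheight y ≤ 1 := by
    intro y hy
    haveI := isIso_stalkMap_of_base_ne_closedPoint π hπ hT.le hy
    have hQ : (π.base y).asIdeal ≠ maximalIdeal T := fun h => hy (PrimeSpectrum.ext h)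
    have hh := height_le_one_of_ne_maximalIdeal hT.le hQ
    have hd := ringKrullDim_stalk_eq_coheight y
    have e := (asIso (π.stalkMap y)).commRingCatIsoToRingEquiv
    letI : Algebra T ((Spec (.of T)).presheaf.stalk (π.base y)) := StructureSheaf.stalkAlgebra T (π.base y)
    haveI : IsLocalization.AtPrime ((Spec (.of T)).presheaf.stalk (π.base y)) (π.base y).asIdeal :=
      StructureSheaf.IsLocalization.to_stalk T (π.base y)
    have hd' : (((π.base y).asIdeal.height : ℕ∞) : WithBot ℕ∞) = coheight y := by
      rw [← IsLocalization.AtPrime.ringKrullDim_eq_height (π.base y).asIdeal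
        ((Spec (.of T)).presheaf.stalk (π.base y)), ringKrullDim_eq_of_ringEquiv e, hd]
    have : (coheight y : WithBot ℕ∞) ≤ (1 : ℕ∞) := by rw [← hd']; exact_mod_cast hh
    exact_mod_cast this
  let C : X.functionField → Prop := fun h => h = 0 ∨ ∀ i : {η // η ∈ F}, (Z₀ i : ℤ) - A₀ i ≤ Scheme.ord h i
  have hC : C (baseToFunctionField π x) := by
    rw [← FractionalIdeal.mem_coe, FractionalIdeal.coe_mul] at hxmem
    refine Submodule.mul_induction_on hxmem (fun m hm n hn => ?_) (fun y z hy hz => ?_)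
    · rw [FractionalIdeal.mem_coe, FractionalIdeal.mem_coeIdeal] at hm
      obtain ⟨a, ha𝔭, rfl⟩ := hm
      rw [FractionalIdeal.mem_coe, FractionalIdeal.mem_inv_iff (FractionalIdeal.coeIdeal_ne_zero.mpr h𝔭0)] at hn
      by_cases hmn : algebraMap T X.functionField a * n = 0
      · exact Or.inl hmn
      right
      have ha0 : baseToFunctionField π a ≠ 0 := fun h0 => hmn (by rw [halg, h0, zero_mul])
      have hn0 : n ≠ 0 := fun h0 => hmn (by rw [h0, mul_zero])
      have hv : ∀ a' ∈ (π.base γ).asIdeal, ∃ b' : T,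
          n * baseToFunctionField π a' = baseToFunctionField π b' := by
        intro a' ha'
        have h1 := hn (algebraMap T _ a') (FractionalIdeal.mem_coeIdeal_of_mem _ ha')
        obtain ⟨b', hb'⟩ := (FractionalIdeal.mem_one_iff (nonZeroDivisors T)).mp h1
        refine ⟨b', ?_⟩
        rw [← halg a', ← halg b']
        exact hb'.symm
      have hs : (-DΓ).IsSectionOn {y | π y ≠ closedPoint T} (baseToFunctionField π a) :=
        fun j y hyj hyE => neg_primeDivisor_isSectionOn_base π hX hγ ha𝔭 j y hyj (hcoh y hyE)
      have hs' : (-(-DΓ)).IsSectionOn {y | π y ≠ closedPoint T} n := by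
        intro j y hyj hyE
        have h := primeDivisor_isSectionOn_of_mul_base_mem π hX hγ hπ hT.le hγE hv j y hyj ⟨hyE, hcoh y hyE⟩
        rw [CartierDivisor.neg_f, CartierDivisor.neg_f, inv_inv]
        exact h
      intro i
      rw [halg]
      exact least_sub_greatest_le_ord_mul_weighted π hX F hF hFexc hFE hneg b hb (-DΓ) hD Z₀ A₀ hZ₀ hA₀ ha0 hn0 hs hs' i
    · rcases hy with hy0 | hy
      · rw [hy0, zero_add]; exact hz
      rcases hz with hz0 | hz
      · rw [hz0, add_zero]; exact Or.inr hy
      by_cases hyz : y + z = 0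
      · exact Or.inl hyz
      right
      intro i
      haveI := isDiscreteValuationRing_stalk_of_coheight_eq_one hX (hF i i.2)
      exact (le_min (hy i) (hz i)).trans (Scheme.ord_add hyz)
  rcases hC with h0 | h
  · exact absurd h0 (by
      rw [← halg]
      exact (map_ne_zero_iff _ (IsFractionRing.injective T X.functionField)).mpr hx0)
  · exact h i

end Sheaf

end Summit.ResolutionOfSingularities.ResolutionOfSingularities.Theorems.HomologicalConductor.PersistencePointedCeiling

end
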